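import Literature.Topology.FourManifolds.LatticeFormsStableOrthogonalGroupNegReflections
import Literature.Topology.FourManifolds.LatticeFormsStableOrthogonalGroupIndex
import Literature.Topology.FourManifolds.LatticeFormsHyperbolicSumDiscriminantForm
import HarnessLib

/-!
# `−σ_r ∈ Õ(L)` for lattices of odd discriminant and for `L_{2d} = 2U ⊕ 2E₈(−1) ⊕ ⟨−2d⟩`
# (Gritsenko–Hulek–Sankaran, *The Kodaira dimension of the moduli of K3 surfaces*, §4 Cor. 4.3, Cor. 4.4 of arXiv:math/0607339)

Trunk T-4MAN vocabulary; sequel of `LatticeFormsStableOrthogonalGroupNegReflections.lean` (row g40-#1: Prop. 4.2 —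
`−σ_r ∈ Õ(L)` ⟹ (i) `r² = ±2D, div(r) = D` odd or `r² = ±D, div(r) ∈ {D, D/2}`, (ii) `A_L ≅ (ℤ/2)^m × ℤ/D`, and
the converses (iii), (iv) under (ii)), of `LatticeFormsStableOrthogonalGroupReflections.lean` (g39-#4: Prop. 4.1) and
of `LatticeFormsStableOrthogonalGroupIndex.lean` (g39-#3: the model `L_{2d} = (E₈(−1)^{⊕2} ⊕ U^{⊕2}) ⊕ ℤ(−2d)`).
Written for lane `lit-hodgefound` (Track 2 foundations; prover seat `lit-hodgefound-p18`, gen 40, row g40-#2).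
THEOREMS ONLY — no definition, no named fact, no instance, no notation. Conventions as in g40-#1: `σ_r` is any
`g ∈ O(L)` with `(r,r)·g(l) = (r,r)·l − 2(l,r)·r`; `r` primitive = `ℤr` saturated; the divisor `div(r) = δ > 0` divides
every `(r, z)` and is attained, `(r, r') = δ`; "`−σ_r ∈ Õ(L)`" is `∀ a, ḡ a = −a`; `D = AddMonoid.exponent A_L`.

## Source, verbatim (held text `paper:arxiv-math_0607339` p. 14, arXiv numbering §4)

"**Corollary 4.3.** Let `L` be an even integral lattice and `|A_L| = |det L|` be odd. Then
(i) `σ_r ∈ Õ(L)` if and only if `r² = ±2`; (ii) `−σ_r ∈ Õ(L)` if and only if `r² = ±2D` and `div(r) = D`.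
With K3 surfaces in mind, we consider in more detail the lattice `L_{2d} = 2U ⊕ 2E₈(−1) ⊕ ⟨−2d⟩`.
**Corollary 4.4.** Let `σ_r` be a reflection in `O(L_{2d})` defined by a primitive vector `r ∈ L_{2d}`. `σ_r` induces
`±id` on the discriminant form `L_{2d}^∨/L_{2d}` if and only if `r² = ±2` or `r² = ±2d` and `div(r) = d` or `2d`.
*Proof.* Any `r ∈ L_{2d}` can be written as `r = m + xh`, where `m ∈ L₀ = 2U ⊕ 2E₈(−1)` and `h² = −2d` (`h` is
primitive). If `r² = ±2d` and `div(r) = 2d`, then `−σ_r ∈ Õ(L_{2d})` by Proposition 4.2. If `r² = ±2d` and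
`div(r) = d`, then `r = dm₀ + xh`, where `x² = 1 − d(m₀²/2)`. We see that
`σ_r(h/2d) = (h/2d)(1 − 2x²) − xm₀ ≡ −h/2d mod L_{2d}`. □"

## Reading notes

* Cor. 4.3 (i) is Prop. 4.1 (`discriminantGroupCongr_reflection_eq_refl_iff`, g39-#4); the parity hypothesis
  plays no role and the statement is not repeated here.
* Cor. 4.3 (ii) "⟹" holds as printed (§1), and yields moreover that `A_L` is cyclic (Prop. 4.2 (ii) with `|A_L|`
  odd). The printed "⟸" is FALSE without that cyclicity: §2 proves that in `U(3)` (`|A| = 9`, `D = 3`) the vector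
  `r = e + f` has `r² = 6 = 2D`, `div(r) = 3 = D`, `σ_r ∈ O(U(3))`, and `σ̄_r ≠ −id`
  (`exists_reflection_odd_card_not_discriminantGroupCongr_eq_neg`). With `A_L` cyclic — which is exactly what the
  proof of Prop. 4.2 (iv) uses ("the group `A_L` is cyclic with generator `r*`") — "⟸" holds (§1), so the corrected
  form proved here is `−σ_r ∈ Õ(L) ⟺ r² = ±2D ∧ div(r) = D ∧ A_L cyclic`.
* Cor. 4.4 is proved for every orthogonal sum `B₀ ⊕ ⟨m⟩` with `B₀` even unimodular and `m = ±2d` (§3; GHS: "the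
  unimodular part `2E₈(−1)` plays no role"), then specialised to the tree's model of `L_{2d}` (§4).

## Contents (all proved)

* §1 Cor. 4.3 (ii): `apply_self_eq_two_mul_exponent_of_discriminantGroupCongr_eq_neg_of_odd` ("⟹", plus `A_L`
  cyclic), `discriminantGroupCongr_eq_neg_of_apply_self_eq_two_mul_exponent_of_cyclic` ("⟸" with `A_L` cyclic),
  `forall_discriminantGroupCongr_eq_neg_iff_of_odd` (the corrected iff).
* §2 `exists_reflection_odd_card_not_discriminantGroupCongr_eq_neg`: the `U(3)` counterexample to the printed "⟸".
* §3 `B₀ ⊕ ⟨m⟩`, `B₀` even unimodular, `m = ±2d`: `prod_smul_mul_mk_eq_apply_zsmul_mk_snd` (`A = ℤ[h*]`,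
  `[φ] = φ(h)[h*]`), `addOrderOf_prod_smul_mul_mk_snd` (`ord[h*] = 2d`), `exponent_prod_smul_mul_discriminantGroup`
  (`D = 2d`), `prod_smul_mul_discriminantGroupCongr_eq_neg_of_dvd` (the printed computation: `r² = ±2d`,
  `d ∣ (r, L) ⟹ σ̄_r = −id`), `prod_smul_mul_discriminantGroupCongr_eq_neg_of_two_mul_dvd` (`div(r) = 2d`), and
  **`prod_smul_mul_discriminantGroupCongr_eq_refl_or_neg_iff`** (Cor. 4.4 for `B₀ ⊕ ⟨±2d⟩`).
* §4 **`latticeL2d_discriminantGroupCongr_eq_refl_or_neg_iff`**: Cor. 4.4 for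
  `L_{2d} = (E₈(−1)^{⊕2} ⊕ U^{⊕2}) ⊕ ℤ(−2d)`.

## References

* [GritsenkoHulekSankaran2007Kodaira] V. Gritsenko, K. Hulek, G. K. Sankaran, The Kodaira dimension of the moduli
  of K3 surfaces, Invent. Math. 169 (2007) 519–567 (arXiv:math/0607339): §4 (arXiv numbering) Cor. 4.3, Cor. 4.4.
* [GritsenkoHulekSankaran2007HM] V. Gritsenko, K. Hulek, G. K. Sankaran, The Hirzebruch–Mumford volume for the
  orthogonal group and applications, Doc. Math. 12 (2007) 215–241: §4 ("`L_{2d} = ⟨−2d⟩ ⊕ 2U ⊕ 2E₈(−1)`").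
* [Huybrechts2016K3] D. Huybrechts, Lectures on K3 Surfaces, CUP 2016, Ch. 14 §0.3 (iv) (`U(m)`, `A_{⟨m⟩}`).
-/

noncomputable section

open Module Function
open LinearMap (BilinForm)
open LinearMap.BilinForm

namespace Literature.Topology.FourManifolds

universe u

/-- `n • [f] = [n • f]` in `A_L = L^∨/L` (the integer action on the quotient versus on `L^∨`). [folklore] -/
private theorem zsmul_mk' {M : Type u} [AddCommGroup M] (B : BilinForm ℤ M) (f : Module.Dual ℤ M) (n : ℤ) :
    (n • (Submodule.Quotient.mk f : B.discriminantGroup)) = Submodule.Quotient.mk (n • f) :=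
  (Submodule.Quotient.mk_smul _ _ _).symm

/-! ### §1 Cor. 4.3 (ii): lattices of odd discriminant -/

section OddDiscriminant

variable {M : Type u} [AddCommGroup M] [Module.Free ℤ M] [Module.Finite ℤ M] (B : BilinForm ℤ M)

/-- **GHS Cor. 4.3 (ii) "⟹", as printed, and the cyclicity of `A_L`**: let `L` be a nondegenerate even lattice with
`|A_L|` odd, `r` primitive and reflective with divisor `d`. If `−σ_r ∈ Õ(L)` then `r² = ±2D`, `div(r) = D` (`D` the
exponent of `A_L`), and `A_L` is cyclic (the exponent is odd, so in Prop. 4.2 (ii) `A_L ≅ (ℤ/2)^m × ℤ/D` the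
`2`-part is trivial). [cite: GritsenkoHulekSankaran2007Kodaira, §4 (arXiv numbering) Cor. 4.3 (ii) ("`−σ_r ∈ Õ(L)` if and only if `r² = ±2D` and `div(r) = D`")] -/
theorem apply_self_eq_two_mul_exponent_of_discriminantGroupCongr_eq_neg_of_odd (hB : B.Nondegenerate)
    (hs : B.IsSymm) (he : B.IsEven) (hodd : Odd (Nat.card B.discriminantGroup)) {r : M} (hr : B r r ≠ 0)
    (hsat : ∀ (k : ℤ) (w : M), k ≠ 0 → k • w ∈ ℤ ∙ r → w ∈ ℤ ∙ r) (g : B.IsometryEquiv B)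
    (hg : ∀ l, B r r • g l = B r r • l - (2 * B l r) • r) {d : ℤ} (hd : 0 < d) (hdvd : ∀ z, d ∣ B r z) {r' : M}
    (hr' : B r r' = d) (hneg : ∀ a, g.discriminantGroupCongr a = -a) :
    (B r r = 2 * AddMonoid.exponent B.discriminantGroup ∨ B r r = -(2 * AddMonoid.exponent B.discriminantGroup : ℤ)) ∧
      d = AddMonoid.exponent B.discriminantGroup ∧
        ∃ x : B.discriminantGroup, ∀ a, a ∈ AddSubgroup.zmultiples x := by
  haveI := finite_discriminantGroup B hB
  have hDodd : Odd (AddMonoid.exponent B.discriminantGroup) :=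
    Odd.of_dvd_nat hodd AddGroup.exponent_dvd_nat_card
  refine ⟨?_, ?_, ?_⟩
  rotate_left 2
  · obtain ⟨x, -, hgen⟩ :=
      exists_addOrderOf_eq_exponent_of_discriminantGroupCongr_eq_neg B hB hs hr hsat g hg hdvd hr' hneg
    refine ⟨x, fun a ↦ ?_⟩
    obtain ⟨k, t, ht, rfl⟩ := hgen a
    rw [eq_zero_of_two_zsmul_eq_zero_of_odd_exponent hDodd ht, add_zero]
    exact AddSubgroup.zsmul_mem _ (AddSubgroup.mem_zmultiples x) k
  all_goals
    rcases apply_self_eq_and_divisor_eq_exponent_of_discriminantGroupCongr_eq_neg B hB hs he hr hsat g hg hd hdvd hr'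
      hneg with ⟨h2, hdD, -⟩ | ⟨h1, -⟩
  · exact h2
  · exfalso
    obtain ⟨k, hk⟩ := he r
    obtain ⟨j, hj⟩ := hDodd
    rcases h1 with h | h <;> omega
  · exact hdD
  · exfalso
    obtain ⟨k, hk⟩ := he r
    obtain ⟨j, hj⟩ := hDodd
    rcases h1 with h | h <;> omega

/-- **GHS Cor. 4.3 (ii) "⟸", with the cyclicity of `A_L` that the printed proof (of Prop. 4.2 (iv): "`D` is odd and
the group `A_L` is cyclic with generator `r*`") uses**: `L` nondegenerate even — here any nondegenerate symmetric —
lattice with `|A_L|` odd and `A_L` cyclic, `r` primitive and reflective with `r² = ±2D` and `div(r) = D`; then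
`−σ_r ∈ Õ(L)`. (Without "`A_L` cyclic" this fails: §2.) [cite: GritsenkoHulekSankaran2007Kodaira, §4 (arXiv numbering) Cor. 4.3 (ii), Prop. 4.2 (iv)] -/
theorem discriminantGroupCongr_eq_neg_of_apply_self_eq_two_mul_exponent_of_cyclic (hB : B.Nondegenerate)
    (hs : B.IsSymm) (hodd : Odd (Nat.card B.discriminantGroup))
    (hcyc : ∃ x : B.discriminantGroup, ∀ a, a ∈ AddSubgroup.zmultiples x) {r : M} (hr : B r r ≠ 0)
    (hsat : ∀ (k : ℤ) (w : M), k ≠ 0 → k • w ∈ ℤ ∙ r → w ∈ ℤ ∙ r) (g : B.IsometryEquiv B)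
    (hg : ∀ l, B r r • g l = B r r • l - (2 * B l r) • r) {d : ℤ} (hd : 0 < d) (hdvd : ∀ z, d ∣ B r z)
    (hr2 : B r r = 2 * AddMonoid.exponent B.discriminantGroup ∨
      B r r = -(2 * AddMonoid.exponent B.discriminantGroup : ℤ))
    (hdD : d = AddMonoid.exponent B.discriminantGroup) : ∀ a, g.discriminantGroupCongr a = -a := by
  haveI := finite_discriminantGroup B hB
  obtain ⟨x, hx⟩ := hcyc
  haveI : IsAddCyclic B.discriminantGroup := ⟨⟨x, hx⟩⟩
  have hord : addOrderOf x = AddMonoid.exponent B.discriminantGroup := by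
    rw [addOrderOf_eq_card_of_forall_mem_zmultiples hx, IsAddCyclic.exponent_eq_card]
  have hDodd : Odd (AddMonoid.exponent B.discriminantGroup) := by
    rw [IsAddCyclic.exponent_eq_card]
    exact hodd
  refine discriminantGroupCongr_eq_neg_of_apply_self_eq_two_mul_exponent B hB hs hr hsat g hg hd hdvd
    ⟨x, hord, fun a ↦ ?_⟩ hr2 hdD hDodd
  obtain ⟨k, hk⟩ := AddSubgroup.mem_zmultiples_iff.1 (hx a)
  exact ⟨k, 0, smul_zero _, by rw [add_zero, hk]⟩

/-- **GHS Cor. 4.3 (ii), corrected: for `|A_L|` odd, `−σ_r ∈ Õ(L) ⟺ r² = ±2D ∧ div(r) = D ∧ A_L` cyclic**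
(`L` nondegenerate even, `r` primitive reflective with divisor `d`). The printed statement omits "`A_L` cyclic",
which is necessary (§2) and is what the printed proof uses. [cite: GritsenkoHulekSankaran2007Kodaira, §4 (arXiv numbering) Cor. 4.3 (ii)] -/
theorem forall_discriminantGroupCongr_eq_neg_iff_of_odd (hB : B.Nondegenerate) (hs : B.IsSymm) (he : B.IsEven)
    (hodd : Odd (Nat.card B.discriminantGroup)) {r : M} (hr : B r r ≠ 0)
    (hsat : ∀ (k : ℤ) (w : M), k ≠ 0 → k • w ∈ ℤ ∙ r → w ∈ ℤ ∙ r) (g : B.IsometryEquiv B)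
    (hg : ∀ l, B r r • g l = B r r • l - (2 * B l r) • r) {d : ℤ} (hd : 0 < d) (hdvd : ∀ z, d ∣ B r z) {r' : M}
    (hr' : B r r' = d) :
    (∀ a, g.discriminantGroupCongr a = -a) ↔
      (B r r = 2 * AddMonoid.exponent B.discriminantGroup ∨
          B r r = -(2 * AddMonoid.exponent B.discriminantGroup : ℤ)) ∧
        d = AddMonoid.exponent B.discriminantGroup ∧ ∃ x : B.discriminantGroup, ∀ a, a ∈ AddSubgroup.zmultiples x :=
  ⟨apply_self_eq_two_mul_exponent_of_discriminantGroupCongr_eq_neg_of_odd B hB hs he hodd hr hsat g hg hd hdvd hr',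
    fun ⟨hr2, hdD, hcyc⟩ ↦ discriminantGroupCongr_eq_neg_of_apply_self_eq_two_mul_exponent_of_cyclic B hB hs hodd
      hcyc hr hsat g hg hd hdvd hr2 hdD⟩

end OddDiscriminant

/-! ### §2 The printed "⟸" of Cor. 4.3 (ii) fails without cyclicity: `U(3)`, `r = e + f` -/

section CounterexampleU3

/-- **`U(3)` refutes the printed "⟸" of GHS Cor. 4.3 (ii).** For `L = U(3)` (`= 3 • hyperbolicSum 1`, basis `e, f`
with `e² = f² = 0`, `ef = 3`): `L` is even and nondegenerate, `|A_L| = 9` is odd, `D = 3`; the primitive vector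
`r = e + f` has `r² = 6 = 2D` and `div(r) = 3 = D` (`(r, e) = 3`), the reflection `σ_r = −(e ↔ f) ∈ O(L)`
(`(r,r)σ_r(l) = (r,r)l − 2(l,r)r`), and yet `σ̄_r ≠ −id` on `A_L = (ℤ/3)²` (`σ̄_r(e/3) = −f/3 ≢ −e/3`). So
"`−σ_r ∈ Õ(L)` if `r² = ±2D` and `div(r) = D`" needs the extra hypothesis "`A_L` cyclic" of §1.
[cite: GritsenkoHulekSankaran2007Kodaira, §4 (arXiv numbering) Cor. 4.3 (ii)] [cite: Huybrechts2016K3, Ch. 14 §0.3 (iv)] -/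
theorem exists_reflection_odd_card_not_discriminantGroupCongr_eq_neg :
    ∃ (r r' : (Fin 1 → ℤ) × (Fin 1 → ℤ))
      (g : ((3 : ℤ) • hyperbolicSum 1).IsometryEquiv ((3 : ℤ) • hyperbolicSum 1)),
      ((3 : ℤ) • hyperbolicSum 1).Nondegenerate ∧ ((3 : ℤ) • hyperbolicSum 1).IsSymm ∧
        ((3 : ℤ) • hyperbolicSum 1).IsEven ∧ Nat.card ((3 : ℤ) • hyperbolicSum 1).discriminantGroup = 9 ∧
        AddMonoid.exponent ((3 : ℤ) • hyperbolicSum 1).discriminantGroup = 3 ∧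
        (∀ (k : ℤ) (w : (Fin 1 → ℤ) × (Fin 1 → ℤ)), k ≠ 0 → k • w ∈ ℤ ∙ r → w ∈ ℤ ∙ r) ∧
        (∀ l, ((3 : ℤ) • hyperbolicSum 1) r r • g l =
          ((3 : ℤ) • hyperbolicSum 1) r r • l - (2 * ((3 : ℤ) • hyperbolicSum 1) l r) • r) ∧
        ((3 : ℤ) • hyperbolicSum 1) r r = 2 * 3 ∧ (∀ z, (3 : ℤ) ∣ ((3 : ℤ) • hyperbolicSum 1) r z) ∧
        ((3 : ℤ) • hyperbolicSum 1) r r' = 3 ∧ ¬ ∀ a, g.discriminantGroupCongr a = -a := by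
  -- abbreviations inside the proof only
  have happ : ∀ p q : (Fin 1 → ℤ) × (Fin 1 → ℤ),
      ((3 : ℤ) • hyperbolicSum 1) p q = 3 * (p.1 0 * q.2 0 + p.2 0 * q.1 0) := fun p q ↦ by
    rw [smul_apply_apply, hyperbolicSum_apply]
    simp [dotProduct]
  have hnd : ((3 : ℤ) • hyperbolicSum 1).Nondegenerate := nondegenerate_smul_hyperbolicSum 3 1 (by norm_num)
  have hsy : ((3 : ℤ) • hyperbolicSum 1).IsSymm := isSymm_smul_hyperbolicSum 3 1
  have hev : ((3 : ℤ) • hyperbolicSum 1).IsEven := isEven_smul_hyperbolicSum 3 1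
  have hcard : Nat.card ((3 : ℤ) • hyperbolicSum 1).discriminantGroup = 9 := by
    rw [natCard_discriminantGroup_smul_hyperbolicSum]; rfl
  haveI : Finite ((3 : ℤ) • hyperbolicSum 1).discriminantGroup := finite_discriminantGroup _ hnd
  -- every `p` is `p.1 0 • e + p.2 0 • f`
  have hdecomp : ∀ p : (Fin 1 → ℤ) × (Fin 1 → ℤ), p = (p.1 0) • ((1 : Fin 1 → ℤ), (0 : Fin 1 → ℤ)) +
      (p.2 0) • ((0 : Fin 1 → ℤ), (1 : Fin 1 → ℤ)) := fun p ↦ by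
    ext i <;> fin_cases i <;> simp
  -- the reflection `σ_r = −(e ↔ f)`
  let e : ((Fin 1 → ℤ) × (Fin 1 → ℤ)) ≃ₗ[ℤ] ((Fin 1 → ℤ) × (Fin 1 → ℤ)) :=
    (LinearEquiv.prodComm ℤ (Fin 1 → ℤ) (Fin 1 → ℤ)).trans (LinearEquiv.neg ℤ)
  have he_apply : ∀ p, e p = (-p.2, -p.1) := fun p ↦ rfl
  let g : ((3 : ℤ) • hyperbolicSum 1).IsometryEquiv ((3 : ℤ) • hyperbolicSum 1) :=
    { toLinearEquiv := e
      map_app' := fun p q ↦ by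
        change ((3 : ℤ) • hyperbolicSum 1) (e p) (e q) = _
        rw [he_apply, he_apply, happ, happ]
        simp only [Pi.neg_apply]
        ring }
  have hg_apply : ∀ p, g p = (-p.2, -p.1) := fun p ↦ rfl
  refine ⟨(1, 1), (1, 0), g, hnd, hsy, hev, hcard, ?_, ?_, ?_, ?_, ?_, ?_, ?_⟩
  · -- `D = 3`
    have h3 : AddMonoid.exponent ((3 : ℤ) • hyperbolicSum 1).discriminantGroup ∣ 3 := by
      rw [AddMonoid.exponent_dvd_iff_forall_nsmul_eq_zero]
      intro a
      obtain ⟨φ, rfl⟩ := ((3 : ℤ) • hyperbolicSum 1).discriminantGroup_mk_surjective a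
      rw [← natCast_zsmul, Nat.cast_ofNat, zsmul_mk', Submodule.Quotient.mk_eq_zero]
      refine ⟨(fun _ ↦ φ (0, 1), fun _ ↦ φ (1, 0)), LinearMap.ext fun p ↦ ?_⟩
      rw [happ, LinearMap.smul_apply, smul_eq_mul]
      conv_rhs => rw [hdecomp p]
      rw [map_add, map_smul, map_smul, smul_eq_mul, smul_eq_mul]
      ring
    have h1 : AddMonoid.exponent ((3 : ℤ) • hyperbolicSum 1).discriminantGroup ≠ 1 := by
      rw [Ne, AddMonoid.exp_eq_one_iff]
      intro hsub
      have := Nat.card_of_subsingleton (0 : ((3 : ℤ) • hyperbolicSum 1).discriminantGroup)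
      omega
    exact (Nat.prime_three.eq_one_or_self_of_dvd _ h3).resolve_left h1
  · -- `r = e + f` is primitive
    intro k w hk hw
    obtain ⟨c, hc⟩ := Submodule.mem_span_singleton.1 hw
    have h1 : c = k * w.1 0 := by simpa using congrArg (fun p : (Fin 1 → ℤ) × (Fin 1 → ℤ) ↦ p.1 0) hc
    have h2 : c = k * w.2 0 := by simpa using congrArg (fun p : (Fin 1 → ℤ) × (Fin 1 → ℤ) ↦ p.2 0) hc
    have h12 : w.1 0 = w.2 0 := mul_left_cancel₀ hk (h1.symm.trans h2)
    refine Submodule.mem_span_singleton.2 ⟨w.1 0, ?_⟩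
    ext i <;> fin_cases i <;> simp [h12]
  · -- the reflection formula
    intro l
    rw [hg_apply, happ, happ]
    ext i <;> fin_cases i <;> simp <;> ring
  · rw [happ]; simp
  · intro z; rw [happ]; exact Dvd.intro _ rfl
  · rw [happ]; simp
  · -- `σ̄_r ≠ −id`: `σ̄_r[e*] + [e*] = [e* ∘ σ_r + e*]` is not in the image of `L`
    intro hneg
    have hr6 : ((3 : ℤ) • hyperbolicSum 1) (1, 1) (1, 1) ≠ 0 := by rw [happ]; simp
    have hgl : ∀ l, ((3 : ℤ) • hyperbolicSum 1) (1, 1) (1, 1) • g l =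
        ((3 : ℤ) • hyperbolicSum 1) (1, 1) (1, 1) • l - (2 * ((3 : ℤ) • hyperbolicSum 1) l (1, 1)) • (1, 1) := by
      intro l
      rw [hg_apply, happ, happ]
      ext i <;> fin_cases i <;> simp <;> ring
    let φ : Module.Dual ℤ ((Fin 1 → ℤ) × (Fin 1 → ℤ)) := (LinearMap.proj 0).comp (LinearMap.fst ℤ _ _)
    have hφ : ∀ p : (Fin 1 → ℤ) × (Fin 1 → ℤ), φ p = p.1 0 := fun p ↦ rfl
    have h1 := hneg (Submodule.Quotient.mk φ)
    rw [IsometryEquiv.discriminantGroupCongr_mk, ← sub_eq_zero, sub_neg_eq_add, ← Submodule.Quotient.mk_add,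
      Submodule.Quotient.mk_eq_zero] at h1
    obtain ⟨q, hq⟩ := LinearMap.mem_range.1 h1
    have h2 := LinearMap.congr_fun hq ((1 : Fin 1 → ℤ), (0 : Fin 1 → ℤ))
    rw [happ, LinearMap.add_apply, LinearEquiv.dualMap_apply, reflection_symm_apply _ hr6 g hgl, hg_apply, hφ, hφ]
      at h2
    simp at h2
    omega

end CounterexampleU3

/-! ### §3 Orthogonal sums `B₀ ⊕ ⟨m⟩`, `B₀` even unimodular, `m = ±2d`: `A = ℤ[h*] ≅ ℤ/2d` and Cor. 4.4 -/

section ProdRankOne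

variable {M₀ : Type u} [AddCommGroup M₀] [Module.Free ℤ M₀] [Module.Finite ℤ M₀] (B₀ : BilinForm ℤ M₀)
  (m : ℤ)

omit [Module.Free ℤ M₀] [Module.Finite ℤ M₀] in
/-- `B₀ ⊕ ⟨m⟩` is nondegenerate, symmetric and even for `B₀` even unimodular and `m` even, `m ≠ 0`.
[cite: GritsenkoHulekSankaran2007HM, §4 ("`L_{2d} = ⟨−2d⟩ ⊕ 2U ⊕ 2E₈(−1)`")] -/
theorem nondegenerate_isSymm_isEven_prod_smul_mul (hs₀ : B₀.IsSymm) (he₀ : B₀.IsEven) (hu₀ : B₀.IsUnimodular)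
    (hm0 : m ≠ 0) (hme : Even m) :
    (B₀.prod (m • LinearMap.mul ℤ ℤ)).Nondegenerate ∧ (B₀.prod (m • LinearMap.mul ℤ ℤ)).IsSymm ∧
      (B₀.prod (m • LinearMap.mul ℤ ℤ)).IsEven := by
  refine ⟨hu₀.nondegenerate.prod ((nondegenerate_zsmul_iff _ hm0).2 nondegenerate_mul), hs₀.prod (isSymm_smul_mul m),
    isEven_prod_iff.2 ⟨he₀, fun y ↦ ?_⟩⟩
  obtain ⟨k, hk⟩ := hme
  exact ⟨k * (y * y), by rw [smul_mul_apply, hk]; ring⟩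

omit [Module.Free ℤ M₀] [Module.Finite ℤ M₀] in
/-- **`(h, ·) = m · h*`** for `h = (0, 1) ∈ B₀ ⊕ ⟨m⟩`: the functional `(h, ·)` is `m` times the coordinate `h* = pr₂`.
[cite: GritsenkoHulekSankaran2007Kodaira, §4 (arXiv numbering) proof of Cor. 4.4 ("`h² = −2d` (`h` is primitive)")] -/
theorem prod_smul_mul_apply_inr_eq_smul_snd :
    (B₀.prod (m • LinearMap.mul ℤ ℤ)) ((0 : M₀), (1 : ℤ)) = m • (LinearMap.snd ℤ M₀ ℤ : Module.Dual ℤ (M₀ × ℤ)) := by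
  refine LinearMap.ext fun p ↦ ?_
  rw [LinearMap.BilinForm.prod_apply, map_zero, LinearMap.zero_apply, zero_add, smul_mul_apply, one_mul, LinearMap.smul_apply,
    LinearMap.snd_apply, smul_eq_mul]

/-- `h = (0, 1)` is primitive in `B₀ ⊕ ⟨m⟩` (`ℤh` is saturated). [cite: GritsenkoHulekSankaran2007Kodaira, §4 (arXiv numbering) proof of Cor. 4.4 ("`h` is primitive")] -/
theorem prod_inr_one_primitive (k : ℤ) (w : M₀ × ℤ) (hk : k ≠ 0) (hw : k • w ∈ ℤ ∙ ((0 : M₀), (1 : ℤ))) :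
    w ∈ ℤ ∙ ((0 : M₀), (1 : ℤ)) := by
  obtain ⟨c, hc⟩ := Submodule.mem_span_singleton.1 hw
  have h1 : k • w.1 = 0 := by
    have := congrArg Prod.fst hc
    simpa using this.symm
  have hw1 : w.1 = 0 := (smul_eq_zero.1 h1).resolve_left hk
  refine Submodule.mem_span_singleton.2 ⟨w.2, ?_⟩
  ext <;> simp [hw1]

omit [Module.Free ℤ M₀] [Module.Finite ℤ M₀] in
/-- **`A_{B₀ ⊕ ⟨m⟩} = ℤ[h*]`: every class is `[φ] = φ(h)·[h*]`** (`B₀` unimodular: the `M₀`-part of any functional is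
represented by a lattice vector). GHS: "Any `r ∈ L_{2d}` can be written as `r = m + xh`, where `m ∈ L₀ = 2U ⊕ 2E₈(−1)`".
[cite: GritsenkoHulekSankaran2007Kodaira, §4 (arXiv numbering) proof of Cor. 4.4] [cite: Huybrechts2016K3, Ch. 14 §0.3 (iv) ("`A_{⟨m⟩} ≅ ℤ/m`")] -/
theorem prod_smul_mul_mk_eq_apply_zsmul_mk_snd (hu₀ : B₀.IsUnimodular) (φ : Module.Dual ℤ (M₀ × ℤ)) :
    (Submodule.Quotient.mk φ : (B₀.prod (m • LinearMap.mul ℤ ℤ)).discriminantGroup) =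
      φ ((0 : M₀), (1 : ℤ)) • Submodule.Quotient.mk (LinearMap.snd ℤ M₀ ℤ : Module.Dual ℤ (M₀ × ℤ)) := by
  haveI : B₀.IsPerfPair := hu₀
  obtain ⟨w, hw⟩ := (LinearMap.IsPerfPair.bijective_left B₀).2 (φ ∘ₗ LinearMap.inl ℤ M₀ ℤ)
  rw [zsmul_mk', eq_comm, Submodule.Quotient.eq]
  refine ⟨(-w, 0), LinearMap.ext fun p ↦ ?_⟩
  have hp : φ p = φ (p.1, 0) + p.2 * φ (0, 1) := by
    conv_lhs => rw [show p = (p.1, (0 : ℤ)) + p.2 • ((0 : M₀), (1 : ℤ)) by ext <;> simp]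
    rw [map_add, map_smul, smul_eq_mul]
  have hw' : B₀ w p.1 = φ (p.1, 0) := by
    have := LinearMap.congr_fun hw p.1
    simpa using this
  rw [LinearMap.BilinForm.prod_apply, map_neg, LinearMap.neg_apply, hw', smul_mul_apply, zero_mul, mul_zero, add_zero,
    LinearMap.sub_apply, LinearMap.smul_apply, LinearMap.snd_apply, smul_eq_mul, hp]
  ring

/-- **`ord[h*] = |m|`** (`= 2d`): the class of `h* = h/m` has order `|m|` in `A_{B₀ ⊕ ⟨m⟩}` (`B₀` unimodular, `m ≠ 0`).
[cite: GritsenkoHulekSankaran2007Kodaira, §4 (arXiv numbering) proof of Cor. 4.4] [cite: Huybrechts2016K3, Ch. 14 §0.3 (iv)] -/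
theorem addOrderOf_prod_smul_mul_mk_snd (hu₀ : B₀.IsUnimodular) (hm0 : m ≠ 0) :
    addOrderOf (Submodule.Quotient.mk (LinearMap.snd ℤ M₀ ℤ : Module.Dual ℤ (M₀ × ℤ)) :
      (B₀.prod (m • LinearMap.mul ℤ ℤ)).discriminantGroup) = m.natAbs :=
  addOrderOf_mk_eq_natAbs_of_primitive (hu₀.nondegenerate.prod ((nondegenerate_zsmul_iff _ hm0).2 nondegenerate_mul))
    hm0 (prod_smul_mul_apply_inr_eq_smul_snd B₀ m).symm (by simp) (prod_inr_one_primitive (M₀ := M₀))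

/-- **The exponent of `A_{B₀ ⊕ ⟨m⟩}` is `|m|`** (`D = 2d` for `L_{2d}`): `A = ℤ[h*]` is cyclic of order `|m|`.
[cite: GritsenkoHulekSankaran2007Kodaira, §4 (arXiv numbering) Cor. 4.4 and Prop. 4.2 ("`D` the exponent of `A_L`")] [cite: Huybrechts2016K3, Ch. 14 §0.3 (iv)] -/
theorem exponent_prod_smul_mul_discriminantGroup (hu₀ : B₀.IsUnimodular) (hm0 : m ≠ 0) :
    AddMonoid.exponent (B₀.prod (m • LinearMap.mul ℤ ℤ)).discriminantGroup = m.natAbs := by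
  refine Nat.dvd_antisymm ?_ ?_
  · have h : ((AddMonoid.exponent (B₀.prod (m • LinearMap.mul ℤ ℤ)).discriminantGroup : ℕ) : ℤ) ∣ (m.natAbs : ℤ) := by
      rw [AddGroup.exponent_dvd_iff_forall_zsmul_eq_zero]
      intro a
      obtain ⟨φ, rfl⟩ := (B₀.prod (m • LinearMap.mul ℤ ℤ)).discriminantGroup_mk_surjective a
      rw [prod_smul_mul_mk_eq_apply_zsmul_mk_snd B₀ m hu₀ φ, smul_smul, mul_comm, mul_smul,
        ← addOrderOf_prod_smul_mul_mk_snd B₀ m hu₀ hm0, natCast_zsmul, addOrderOf_nsmul_eq_zero, zsmul_zero]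
    exact Int.natCast_dvd_natCast.1 h
  · rw [← addOrderOf_prod_smul_mul_mk_snd B₀ m hu₀ hm0]
    exact AddMonoid.addOrder_dvd_exponent _

variable {d : ℕ}

/-- **The printed computation of Cor. 4.4: `r² = ±2d` and `d ∣ (r, L)` give `σ̄_r = −id` on `A_{B₀ ⊕ ⟨±2d⟩}`**
(`B₀` even unimodular). "If `r² = ±2d` and `div(r) = d`, then `r = dm₀ + xh`, where `x² = 1 − d(m₀²/2)`. We see that
`σ_r(h/2d) = (h/2d)(1 − 2x²) − xm₀ ≡ −h/2d mod L_{2d}`." Here, for `r = (r₁, x)`: `d ∣ (r, (n,0)) = (r₁, n)₀` for all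
`n` forces `r₁ = d·m₀` by unimodularity of `B₀`; with `m = 2ηd` and `r² = 2εd` (`η, ε = ±1`) one gets
`r* = (m₀,0)^♭ + 2ηx·h*` and `d(m₀²/2) + ηx² = ε`; since `A = ℤ[h*]` (`[φ] = φ(h)[h*]`), condition (−id) reduces to
`2d ∣ 2φ(h)(1 − εηx²) − 2εηx·d·φ(m₀,0)`, which holds because `1 − εηx² = εd(m₀²/2)`.
[cite: GritsenkoHulekSankaran2007Kodaira, §4 (arXiv numbering) proof of Cor. 4.4] -/
theorem prod_smul_mul_discriminantGroupCongr_eq_neg_of_dvd (hs₀ : B₀.IsSymm) (he₀ : B₀.IsEven)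
    (hu₀ : B₀.IsUnimodular) (hd : 0 < d) (hm : m = 2 * d ∨ m = -(2 * d)) {r : M₀ × ℤ}
    (g : (B₀.prod (m • LinearMap.mul ℤ ℤ)).IsometryEquiv (B₀.prod (m • LinearMap.mul ℤ ℤ)))
    (hg : ∀ l, (B₀.prod (m • LinearMap.mul ℤ ℤ)) r r • g l =
      (B₀.prod (m • LinearMap.mul ℤ ℤ)) r r • l - (2 * (B₀.prod (m • LinearMap.mul ℤ ℤ)) l r) • r)
    (hdvd : ∀ z, (d : ℤ) ∣ (B₀.prod (m • LinearMap.mul ℤ ℤ)) r z)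
    (hr2 : (B₀.prod (m • LinearMap.mul ℤ ℤ)) r r = 2 * d ∨ (B₀.prod (m • LinearMap.mul ℤ ℤ)) r r = -(2 * d : ℤ)) :
    ∀ a, g.discriminantGroupCongr a = -a := by
  have hd0 : (d : ℤ) ≠ 0 := by exact_mod_cast hd.ne'
  have hm0 : m ≠ 0 := by rcases hm with rfl | rfl <;> omega
  have hme : Even m := by rcases hm with rfl | rfl; exacts [even_two_mul _, (even_two_mul _).neg]
  obtain ⟨hB, hs, -⟩ := nondegenerate_isSymm_isEven_prod_smul_mul B₀ m hs₀ he₀ hu₀ hm0 hme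
  -- signs: `m = 2ηd`, `r² = 2εd`
  obtain ⟨η, hη, hmη⟩ : ∃ η : ℤ, (η = 1 ∨ η = -1) ∧ m = 2 * η * d := by
    rcases hm with h | h
    · exact ⟨1, Or.inl rfl, by rw [h]; ring⟩
    · exact ⟨-1, Or.inr rfl, by rw [h]; ring⟩
  obtain ⟨ε, hε, hrε⟩ : ∃ ε : ℤ, (ε = 1 ∨ ε = -1) ∧ (B₀.prod (m • LinearMap.mul ℤ ℤ)) r r = 2 * ε * d := by
    rcases hr2 with h | h
    · exact ⟨1, Or.inl rfl, by rw [h]; ring⟩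
    · exact ⟨-1, Or.inr rfl, by rw [h]; ring⟩
  have hεε : ε * ε = 1 := by rcases hε with rfl | rfl <;> norm_num
  have hηη : η * η = 1 := by rcases hη with rfl | rfl <;> norm_num
  have hr : (B₀.prod (m • LinearMap.mul ℤ ℤ)) r r ≠ 0 := by
    rw [hrε]; rcases hε with rfl | rfl <;> omega
  -- `r₁ = d • m₀` by unimodularity of `B₀`
  haveI : B₀.IsPerfPair := hu₀
  have hdvd₁ : ∀ n : M₀, (d : ℤ) ∣ B₀ r.1 n := fun n ↦ by
    have := hdvd (n, 0)
    rwa [LinearMap.BilinForm.prod_apply, smul_mul_apply, mul_zero, mul_zero, add_zero] at this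
  obtain ⟨ψ, hψ⟩ := exists_dual_smul_eq_of_forall_dvd B₀ hdvd₁
  obtain ⟨m₀, hm₀⟩ := (LinearMap.IsPerfPair.bijective_left B₀).2 ψ
  have hr1 : r.1 = (d : ℤ) • m₀ := by
    refine injective_of_nondegenerate B₀ hu₀.nondegenerate ?_
    rw [map_smul, hm₀, hψ]
  obtain ⟨k₀, hk₀⟩ := he₀ m₀
  -- `r* = f` with `d • f = (r, ·)`: `f = (m₀, 0)^♭ + (2ηx) h*`
  set x : ℤ := r.2 with hx
  set f : Module.Dual ℤ (M₀ × ℤ) :=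
    (B₀.prod (m • LinearMap.mul ℤ ℤ)) (m₀, 0) + (2 * η * x) • (LinearMap.snd ℤ M₀ ℤ : Module.Dual ℤ (M₀ × ℤ)) with hf
  have hfr : (d : ℤ) • f = (B₀.prod (m • LinearMap.mul ℤ ℤ)) r := by
    refine LinearMap.ext fun p ↦ ?_
    rw [LinearMap.smul_apply, hf, LinearMap.add_apply, LinearMap.smul_apply, LinearMap.BilinForm.prod_apply, LinearMap.BilinForm.prod_apply, smul_mul_apply,
      smul_mul_apply, zero_mul, mul_zero, add_zero, LinearMap.snd_apply, smul_eq_mul, smul_eq_mul,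
      show r = (r.1, x) from rfl, hr1, map_smul, LinearMap.smul_apply, smul_eq_mul, hmη]
    ring
  -- the relation `d k₀ + η x² = ε` from `r² = 2εd`
  have hrel : (d : ℤ) * k₀ + η * (x * x) = ε := by
    have h1 : (B₀.prod (m • LinearMap.mul ℤ ℤ)) r r = (d : ℤ) * ((d : ℤ) * (k₀ + k₀)) + m * (x * x) := by
      conv_lhs => rw [show r = (r.1, x) from rfl, LinearMap.BilinForm.prod_apply]
      dsimp only
      rw [hr1]
      simp only [map_smul, LinearMap.smul_apply, smul_eq_mul, LinearMap.mul_apply', hk₀]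
    have h' : (d : ℤ) * (2 * ((d : ℤ) * k₀ + η * (x * x))) = (d : ℤ) * (2 * ε) := by
      rw [h1, hmη] at hrε
      linear_combination hrε
    have := mul_left_cancel₀ hd0 h'
    linarith
  -- condition (−id) with `c = 2ε`, `c' = ε`
  refine (forall_discriminantGroupCongr_eq_neg_iff_mk _ hs hr g hg (c := 2 * ε) (c' := ε)
    (by linear_combination 2 * hεε) hrε hfr).2 fun φ ↦ ?_
  have hf' : (Submodule.Quotient.mk f : (B₀.prod (m • LinearMap.mul ℤ ℤ)).discriminantGroup) =
      (2 * η * x) • Submodule.Quotient.mk (LinearMap.snd ℤ M₀ ℤ : Module.Dual ℤ (M₀ × ℤ)) := by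
    rw [hf, Submodule.Quotient.mk_add, discriminantGroup_mk_apply, zero_add, ← zsmul_mk']
  rw [prod_smul_mul_mk_eq_apply_zsmul_mk_snd B₀ m hu₀ φ, hf', smul_smul, smul_smul, ← sub_eq_zero, ← sub_smul,
    zsmul_mk', zsmul_mk_eq_zero_iff_dvd_of_primitive hB hm0 (prod_smul_mul_apply_inr_eq_smul_snd B₀ m).symm (by simp)
      (prod_inr_one_primitive (M₀ := M₀))]
  -- `φ(r) = d φ(m₀,0) + x φ(h)`
  have hφr : φ r = (d : ℤ) * φ (m₀, 0) + x * φ (0, 1) := by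
    conv_lhs => rw [show r = (r.1, x) from rfl, hr1,
      show (((d : ℤ) • m₀, x) : M₀ × ℤ) = (d : ℤ) • (m₀, (0 : ℤ)) + x • ((0 : M₀), (1 : ℤ)) by ext <;> simp]
    rw [map_add, map_smul, map_smul, smul_eq_mul, smul_eq_mul]
  rw [hφr, hmη]
  -- `2φ(h)(1 − εηx²) − 2εηx·d·φ(m₀,0)`, and `1 − εηx² = ε d k₀`
  have key : 2 * φ (0, 1) - ε * ((d : ℤ) * φ (m₀, 0) + x * φ (0, 1)) * (2 * η * x) =
      2 * η * (d : ℤ) * (η * ε * k₀ * φ (0, 1) - ε * x * φ (m₀, 0)) := by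
    linear_combination (-2 * φ ((0 : M₀), (1 : ℤ))) * hεε + (-2 * ε * (d : ℤ) * k₀ * φ ((0 : M₀), (1 : ℤ))) * hηη +
      (-2 * ε * φ ((0 : M₀), (1 : ℤ))) * hrel
  rw [key]
  exact Dvd.intro _ rfl

/-- **`r² = ±2d` with `div(r) = 2d` gives `σ̄_r = −id` on `A_{B₀ ⊕ ⟨±2d⟩}`** ("If `r² = ±2d` and `div(r) = 2d`, then
`−σ_r ∈ Õ(L_{2d})` by Proposition 4.2" — case `div(r) = |r²|` of Prop. 4.2 (iii): `[r*]` has order `2d = |A|`, so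
`A = ℤ[r*]`). [cite: GritsenkoHulekSankaran2007Kodaira, §4 (arXiv numbering) proof of Cor. 4.4, Prop. 4.2 (iii)] -/
theorem prod_smul_mul_discriminantGroupCongr_eq_neg_of_two_mul_dvd (hs₀ : B₀.IsSymm) (he₀ : B₀.IsEven)
    (hu₀ : B₀.IsUnimodular) (hd : 0 < d) (hm : m = 2 * d ∨ m = -(2 * d)) {r : M₀ × ℤ}
    (hsat : ∀ (k : ℤ) (w : M₀ × ℤ), k ≠ 0 → k • w ∈ ℤ ∙ r → w ∈ ℤ ∙ r)
    (g : (B₀.prod (m • LinearMap.mul ℤ ℤ)).IsometryEquiv (B₀.prod (m • LinearMap.mul ℤ ℤ)))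
    (hg : ∀ l, (B₀.prod (m • LinearMap.mul ℤ ℤ)) r r • g l =
      (B₀.prod (m • LinearMap.mul ℤ ℤ)) r r • l - (2 * (B₀.prod (m • LinearMap.mul ℤ ℤ)) l r) • r)
    (hdvd : ∀ z, (2 * d : ℤ) ∣ (B₀.prod (m • LinearMap.mul ℤ ℤ)) r z)
    (hr2 : (B₀.prod (m • LinearMap.mul ℤ ℤ)) r r = 2 * d ∨ (B₀.prod (m • LinearMap.mul ℤ ℤ)) r r = -(2 * d : ℤ)) :
    ∀ a, g.discriminantGroupCongr a = -a := by
  have hm0 : m ≠ 0 := by rcases hm with rfl | rfl <;> omega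
  have hmabs : m.natAbs = 2 * d := by rcases hm with rfl | rfl <;> omega
  have hme : Even m := by rcases hm with rfl | rfl; exacts [even_two_mul _, (even_two_mul _).neg]
  obtain ⟨hB, hs, -⟩ := nondegenerate_isSymm_isEven_prod_smul_mul B₀ m hs₀ he₀ hu₀ hm0 hme
  haveI := finite_discriminantGroup _ hB
  have hr : (B₀.prod (m • LinearMap.mul ℤ ℤ)) r r ≠ 0 := by rcases hr2 with h | h <;> rw [h] <;> omega
  have hr0 : r ≠ 0 := fun h ↦ hr (by simp [h])
  obtain ⟨c, hc1, hc⟩ : ∃ c : ℤ, (c = 1 ∨ c = -1) ∧ (B₀.prod (m • LinearMap.mul ℤ ℤ)) r r = c * (2 * d : ℤ) := by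
    rcases hr2 with h | h
    · exact ⟨1, Or.inl rfl, by rw [h, one_mul]⟩
    · exact ⟨-1, Or.inr rfl, by rw [h, neg_one_mul]⟩
  obtain ⟨f, hf⟩ := exists_dual_smul_eq_of_forall_dvd _ hdvd
  refine discriminantGroupCongr_eq_neg_of_forall_eq_zsmul_mk_add _ hB hs hr hsat g hg (by positivity) hdvd
    (c' := 2 * c) (by rcases hc1 with rfl | rfl <;> norm_num) hc hc1 hf fun a ↦ ?_
  -- `A = ℤ[h*] = ℤ[r*]` (both of order `2d`)
  have hordf : addOrderOf (Submodule.Quotient.mk f : (B₀.prod (m • LinearMap.mul ℤ ℤ)).discriminantGroup) =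
      addOrderOf (Submodule.Quotient.mk (LinearMap.snd ℤ M₀ ℤ : Module.Dual ℤ (M₀ × ℤ)) :
        (B₀.prod (m • LinearMap.mul ℤ ℤ)).discriminantGroup) := by
    rw [addOrderOf_mk_eq_natAbs_of_primitive hB (by positivity) hf hr0 hsat, addOrderOf_prod_smul_mul_mk_snd B₀ m hu₀ hm0,
      hmabs]
    omega
  have hmem : ∀ b : (B₀.prod (m • LinearMap.mul ℤ ℤ)).discriminantGroup,
      b ∈ AddSubgroup.zmultiples (Submodule.Quotient.mk (LinearMap.snd ℤ M₀ ℤ : Module.Dual ℤ (M₀ × ℤ))) := fun b ↦ by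
    obtain ⟨φ, rfl⟩ := (B₀.prod (m • LinearMap.mul ℤ ℤ)).discriminantGroup_mk_surjective b
    rw [prod_smul_mul_mk_eq_apply_zsmul_mk_snd B₀ m hu₀ φ]
    exact AddSubgroup.zsmul_mem _ (AddSubgroup.mem_zmultiples _) _
  have heq := zmultiples_eq_of_mem_of_addOrderOf_eq (hmem _) hordf
  obtain ⟨k, hk⟩ := AddSubgroup.mem_zmultiples_iff.1 (heq.symm ▸ hmem a :
    a ∈ AddSubgroup.zmultiples (Submodule.Quotient.mk f : (B₀.prod (m • LinearMap.mul ℤ ℤ)).discriminantGroup))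
  exact ⟨k, 0, smul_zero _, by rw [add_zero, hk]⟩

/-- **GHS Cor. 4.4 for `B₀ ⊕ ⟨m⟩`, `B₀` even unimodular, `m = ±2d` (`d ≥ 1`).** Let `r` be primitive with
`σ_r ∈ O(L)` and divisor `δ = div(r)`. Then `σ_r` induces `±id` on `A_L` — `σ̄_r = id` or `σ̄_r = −id` — if and
only if `r² = ±2`, or `r² = ±2d` and `div(r) ∈ {d, 2d}`. ("⟹": Prop. 4.1 for `+id`; Prop. 4.2 (i) with `D = 2d` for
`−id` — its branch `r² = ±2D, div(r) = D` odd is void as `D = 2d` is even. "⟸": Prop. 4.1, the computation above, and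
the case `div(r) = 2d`.) [cite: GritsenkoHulekSankaran2007Kodaira, §4 (arXiv numbering) Cor. 4.4 ("`σ_r` induces `±id` on the discriminant form `L_{2d}^∨/L_{2d}` if and only if `r² = ±2` or `r² = ±2d` and `div(r) = d` or `2d`")] -/
theorem prod_smul_mul_discriminantGroupCongr_eq_refl_or_neg_iff (hs₀ : B₀.IsSymm) (he₀ : B₀.IsEven)
    (hu₀ : B₀.IsUnimodular) (hd : 0 < d) (hm : m = 2 * d ∨ m = -(2 * d)) {r : M₀ × ℤ}
    (hr : (B₀.prod (m • LinearMap.mul ℤ ℤ)) r r ≠ 0)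
    (hsat : ∀ (k : ℤ) (w : M₀ × ℤ), k ≠ 0 → k • w ∈ ℤ ∙ r → w ∈ ℤ ∙ r)
    (g : (B₀.prod (m • LinearMap.mul ℤ ℤ)).IsometryEquiv (B₀.prod (m • LinearMap.mul ℤ ℤ)))
    (hg : ∀ l, (B₀.prod (m • LinearMap.mul ℤ ℤ)) r r • g l =
      (B₀.prod (m • LinearMap.mul ℤ ℤ)) r r • l - (2 * (B₀.prod (m • LinearMap.mul ℤ ℤ)) l r) • r)
    {δ : ℤ} (hδ : 0 < δ) (hδdvd : ∀ z, δ ∣ (B₀.prod (m • LinearMap.mul ℤ ℤ)) r z) {r' : M₀ × ℤ}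
    (hr' : (B₀.prod (m • LinearMap.mul ℤ ℤ)) r r' = δ) :
    (g.discriminantGroupCongr = LinearEquiv.refl ℤ _ ∨ ∀ a, g.discriminantGroupCongr a = -a) ↔
      ((B₀.prod (m • LinearMap.mul ℤ ℤ)) r r = 2 ∨ (B₀.prod (m • LinearMap.mul ℤ ℤ)) r r = -2) ∨
        (((B₀.prod (m • LinearMap.mul ℤ ℤ)) r r = 2 * d ∨ (B₀.prod (m • LinearMap.mul ℤ ℤ)) r r = -(2 * d : ℤ)) ∧
          (δ = d ∨ δ = 2 * d)) := by
  have hm0 : m ≠ 0 := by rcases hm with rfl | rfl <;> omega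
  have hmabs : m.natAbs = 2 * d := by rcases hm with rfl | rfl <;> omega
  have hme : Even m := by rcases hm with rfl | rfl; exacts [even_two_mul _, (even_two_mul _).neg]
  obtain ⟨hB, hs, he⟩ := nondegenerate_isSymm_isEven_prod_smul_mul B₀ m hs₀ he₀ hu₀ hm0 hme
  have hD : (AddMonoid.exponent (B₀.prod (m • LinearMap.mul ℤ ℤ)).discriminantGroup : ℤ) = 2 * d := by
    rw [exponent_prod_smul_mul_discriminantGroup B₀ m hu₀ hm0, hmabs]; push_cast; ring
  constructor
  · rintro (hid | hneg)
    · exact Or.inl ((discriminantGroupCongr_reflection_eq_refl_iff _ hB hs he hr hsat g hg).1 hid)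
    · right
      rcases apply_self_eq_and_divisor_eq_exponent_of_discriminantGroupCongr_eq_neg _ hB hs he hr hsat g hg hδ hδdvd
          hr' hneg with ⟨-, hδD, hodd⟩ | ⟨h2, hδD⟩
      · exfalso
        rw [← Int.odd_coe_nat, hD] at hodd
        exact Int.not_even_iff_odd.2 hodd (even_two_mul _)
      · rw [hD] at h2 hδD
        exact ⟨h2, hδD.symm.imp (fun h ↦ by omega) fun h ↦ h⟩
  · rintro (h2 | ⟨h2d, hδd | hδ2d⟩)
    · exact Or.inl ((discriminantGroupCongr_reflection_eq_refl_iff _ hB hs he hr hsat g hg).2 h2)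
    · exact Or.inr (prod_smul_mul_discriminantGroupCongr_eq_neg_of_dvd B₀ m hs₀ he₀ hu₀ hd hm g hg
        (fun z ↦ hδd ▸ hδdvd z) h2d)
    · exact Or.inr (prod_smul_mul_discriminantGroupCongr_eq_neg_of_two_mul_dvd B₀ m hs₀ he₀ hu₀ hd hm hsat g hg
        (fun z ↦ hδ2d ▸ hδdvd z) h2d)

end ProdRankOne

/-! ### §4 Cor. 4.4 for the model `L_{2d} = (E₈(−1)^{⊕2} ⊕ U^{⊕2}) ⊕ ℤ(−2d)` -/

section K3

/-- `E₈(−1)^{⊕2} ⊕ U^{⊕2}` is symmetric, even and unimodular.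
[cite: GritsenkoHulekSankaran2007Kodaira, §4 (arXiv numbering) proof of Cor. 4.4 ("`L₀ = 2U ⊕ 2E₈(−1)`")] -/
theorem isSymm_isEven_isUnimodular_pi_neg_e8Form_prod_hyperbolicSum :
    ((LinearMap.BilinForm.pi fun _ : Fin 2 ↦ -e8Form).prod (hyperbolicSum 2)).IsSymm ∧
      ((LinearMap.BilinForm.pi fun _ : Fin 2 ↦ -e8Form).prod (hyperbolicSum 2)).IsEven ∧
        ((LinearMap.BilinForm.pi fun _ : Fin 2 ↦ -e8Form).prod (hyperbolicSum 2)).IsUnimodular := by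
  obtain ⟨hsP, heP, huP⟩ := isSymm_isEven_isUnimodular_pi_neg_e8Form (m := 2)
  exact ⟨hsP.prod (isSymm_hyperbolicSum 2), isEven_prod_iff.2 ⟨heP, isEven_hyperbolicSum 2⟩,
    isUnimodular_prod_iff.2 ⟨huP, isUnimodular_hyperbolicSum 2⟩⟩

/-- **GHS Cor. 4.4, as printed, for `L_{2d} = (E₈(−1)^{⊕2} ⊕ U^{⊕2}) ⊕ ℤ(−2d)`** (`d ≥ 1`): for a primitive `r`
with `σ_r ∈ O(L_{2d})` and divisor `δ = div(r)`, `σ_r` induces `±id` on `A_{L_{2d}}` if and only if `r² = ±2`, or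
`r² = ±2d` and `div(r) ∈ {d, 2d}`. [cite: GritsenkoHulekSankaran2007Kodaira, §4 (arXiv numbering) Cor. 4.4] [cite: GritsenkoHulekSankaran2007HM, §4 ("`L_{2d} = ⟨−2d⟩ ⊕ 2U ⊕ 2E₈(−1)`")] -/
theorem latticeL2d_discriminantGroupCongr_eq_refl_or_neg_iff {d : ℕ} (hd : 0 < d)
    {r : ((Fin 2 → Fin 8 → ℤ) × ((Fin 2 → ℤ) × (Fin 2 → ℤ))) × ℤ}
    (hr : (((LinearMap.BilinForm.pi fun _ : Fin 2 ↦ -e8Form).prod (hyperbolicSum 2)).prod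
      ((-(2 * d : ℤ)) • LinearMap.mul ℤ ℤ)) r r ≠ 0)
    (hsat : ∀ (k : ℤ) (w : ((Fin 2 → Fin 8 → ℤ) × ((Fin 2 → ℤ) × (Fin 2 → ℤ))) × ℤ),
      k ≠ 0 → k • w ∈ ℤ ∙ r → w ∈ ℤ ∙ r)
    (g : (((LinearMap.BilinForm.pi fun _ : Fin 2 ↦ -e8Form).prod (hyperbolicSum 2)).prod
        ((-(2 * d : ℤ)) • LinearMap.mul ℤ ℤ)).IsometryEquiv
      (((LinearMap.BilinForm.pi fun _ : Fin 2 ↦ -e8Form).prod (hyperbolicSum 2)).prod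
        ((-(2 * d : ℤ)) • LinearMap.mul ℤ ℤ)))
    (hg : ∀ l, (((LinearMap.BilinForm.pi fun _ : Fin 2 ↦ -e8Form).prod (hyperbolicSum 2)).prod
        ((-(2 * d : ℤ)) • LinearMap.mul ℤ ℤ)) r r • g l =
      (((LinearMap.BilinForm.pi fun _ : Fin 2 ↦ -e8Form).prod (hyperbolicSum 2)).prod
        ((-(2 * d : ℤ)) • LinearMap.mul ℤ ℤ)) r r • l -
        (2 * (((LinearMap.BilinForm.pi fun _ : Fin 2 ↦ -e8Form).prod (hyperbolicSum 2)).prod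
          ((-(2 * d : ℤ)) • LinearMap.mul ℤ ℤ)) l r) • r)
    {δ : ℤ} (hδ : 0 < δ)
    (hδdvd : ∀ z, δ ∣ (((LinearMap.BilinForm.pi fun _ : Fin 2 ↦ -e8Form).prod (hyperbolicSum 2)).prod
      ((-(2 * d : ℤ)) • LinearMap.mul ℤ ℤ)) r z)
    {r' : ((Fin 2 → Fin 8 → ℤ) × ((Fin 2 → ℤ) × (Fin 2 → ℤ))) × ℤ}
    (hr' : (((LinearMap.BilinForm.pi fun _ : Fin 2 ↦ -e8Form).prod (hyperbolicSum 2)).prod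
      ((-(2 * d : ℤ)) • LinearMap.mul ℤ ℤ)) r r' = δ) :
    (g.discriminantGroupCongr = LinearEquiv.refl ℤ _ ∨ ∀ a, g.discriminantGroupCongr a = -a) ↔
      ((((LinearMap.BilinForm.pi fun _ : Fin 2 ↦ -e8Form).prod (hyperbolicSum 2)).prod
            ((-(2 * d : ℤ)) • LinearMap.mul ℤ ℤ)) r r = 2 ∨
          (((LinearMap.BilinForm.pi fun _ : Fin 2 ↦ -e8Form).prod (hyperbolicSum 2)).prod
            ((-(2 * d : ℤ)) • LinearMap.mul ℤ ℤ)) r r = -2) ∨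
        (((((LinearMap.BilinForm.pi fun _ : Fin 2 ↦ -e8Form).prod (hyperbolicSum 2)).prod
              ((-(2 * d : ℤ)) • LinearMap.mul ℤ ℤ)) r r = 2 * d ∨
            (((LinearMap.BilinForm.pi fun _ : Fin 2 ↦ -e8Form).prod (hyperbolicSum 2)).prod
              ((-(2 * d : ℤ)) • LinearMap.mul ℤ ℤ)) r r = -(2 * d : ℤ)) ∧
          (δ = d ∨ δ = 2 * d)) := by
  obtain ⟨hs₀, he₀, hu₀⟩ := isSymm_isEven_isUnimodular_pi_neg_e8Form_prod_hyperbolicSum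
  exact prod_smul_mul_discriminantGroupCongr_eq_refl_or_neg_iff _ _ hs₀ he₀ hu₀ hd (Or.inr rfl) hr hsat g hg hδ hδdvd hr'

end K3


end Literature.Topology.FourManifolds

end
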